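import Mathlib

/-!
# Gram matrices of columns of an invertible matrix are non-singular

Stub `stub_gramOfColumns_det_ne_zero` of crux `stmt-QuantumFields-9151`
(`Summit.QuantumFields.QCD.Theses.PauliWegnerSea.PhaseQuenchedFlavourDecay`,
line `crossing-split-integrability`).

If `D` is a square complex matrix with `det D ≠ 0` and `J : Fin k → n` is an injective
enumeration of some of its column indices, then the `n × k` matrix `B = D[·, J]` of the selected
columns has linearly independent columns, so its Gram matrix `Bᴴ * B` is positive definite and in
particular `det (Bᴴ * B) ≠ 0`.

Proof: `B = D * P` with `P = (1 : Matrix n n ℂ)[·, J]` the `0/1` column-selection matrix;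
`P.mulVec` has the left inverse `y ↦ y ∘ J` (injectivity of `J`) and `D.mulVec` is injective
(`D` is a unit), hence `B.mulVec` is injective and `Matrix.PosDef.conjTranspose_mul_self`
applies (for the scoped order `ComplexOrder` on `ℂ`); a positive definite matrix is a unit.
-/

namespace Summit.QuantumFields.QCD.Cruxes.PhaseQuenchedFlavourDecay.CrossingSplitIntegrability

open scoped ComplexOrder

/-- **Gram matrices of columns of an invertible matrix are non-singular.**
If `D : Matrix n n ℂ` has `det D ≠ 0` and `J : Fin k → n` is injective, then the Gram matrix
`(D[·, J])ᴴ * D[·, J]` of the columns `J` of `D` has non-zero determinant. -/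
theorem stub_gramOfColumns_det_ne_zero :
    ∀ (n : Type) [Fintype n] [DecidableEq n] (k : ℕ) (D : Matrix n n ℂ) (J : Fin k → n),
      Function.Injective J → D.det ≠ 0 → ((D.submatrix id J).conjTranspose * D.submatrix id J).det ≠ 0 := by
  intro n _ _ k D J hJ hD
  -- the `0/1` column-selection matrix `P = 1[·, J]`, so that `D[·, J] = D * P`
  set P : Matrix n (Fin k) ℂ := (1 : Matrix n n ℂ).submatrix id J with hP
  have hBP : D.submatrix id J = D * P := by
    ext i a
    simp [hP, Matrix.mul_apply, Matrix.one_apply]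
  -- `P.mulVec` has the left inverse `y ↦ y ∘ J`, by injectivity of `J`
  have hPinj : Function.Injective P.mulVec := by
    refine Function.LeftInverse.injective (g := fun y : n → ℂ => y ∘ J) fun x => ?_
    funext b
    simp [hP, Matrix.mulVec, dotProduct, Matrix.one_apply, hJ.eq_iff]
  -- `D.mulVec` is injective since `D` is a unit
  have hDinj : Function.Injective D.mulVec :=
    Matrix.mulVec_injective_iff_isUnit.mpr ((Matrix.isUnit_iff_isUnit_det D).mpr hD.isUnit)
  -- hence the selected columns are linearly independent
  have hBinj : Function.Injective (D.submatrix id J).mulVec := by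
    have hcomp : (D.submatrix id J).mulVec = D.mulVec ∘ P.mulVec := by
      funext x
      simp [hBP]
    rw [hcomp]
    exact hDinj.comp hPinj
  -- so the Gram matrix is positive definite, in particular a unit
  have hpd : ((D.submatrix id J).conjTranspose * D.submatrix id J).PosDef :=
    Matrix.PosDef.conjTranspose_mul_self _ hBinj
  exact ((Matrix.isUnit_iff_isUnit_det _).mp hpd.isUnit).ne_zero

end Summit.QuantumFields.QCD.Cruxes.PhaseQuenchedFlavourDecay.CrossingSplitIntegrability
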